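import Mathlib.Algebra.Star.UnitaryStarAlgAut
import Literature.MathematicalPhysics.QuantumLattice.LiebFluxPhase
import Literature.MathematicalPhysics.QuantumLattice.FermionRelabelling
import Literature.MathematicalPhysics.QuantumLattice.DuhamelTwoPoint
import HarnessLib

/-!
# Gauge invariance, hermiticity and relabelling covariance of the Peierls–Hubbard Hamiltonian

Support file for the proof of Lieb's flux-phase theorem `Lieb1994_fluxPi_torus`
(`LiebFluxPhase.lean`; E. H. Lieb, PRL **73** (1994) 2158). Three standard facts about
`peierlsHubbard G T U = -Σ_σ Σ_{x∼y} T σ x y c†_{xσ}c_{yσ} + U Σ_x (n_{x↑}-½)(n_{x↓}-½)`: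

* **gauge invariance** [Lieb1994, p. 1: "the spectrum … depends on the `φ`'s only through the
  fluxes"; p. 3: "a simple gauge transformation `c_r → exp[-iΘ(l,r)] c_r`"]: the diagonal unitary
  `orbitalPhase g |s⟩ = (∏_{i∈s} g i)|s⟩` (orbital-dependent phases, so spin-dependent gauges are allowed) (`|g i| = 1`) conjugates `c†_i ↦ g i c†_i`, `c_i ↦ g i^* c_i`
  (`orbitalPhase_conj_creation`, `orbitalPhase_conj_annihilation`), hence
  `D H(T) Dᴴ = H(T')` with `T' σ x y = g σ x (g σ y)^* T σ x y` (`orbitalPhase_conj_peierlsHubbard`)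
  and `Z_β(T') = Z_β(T)` (`partitionFn_peierlsHubbard_gauge`);
* **hermiticity** for `T σ y x = (T σ x y)^*` (`peierlsHubbard_isHermitian`), so `Z_β` is real and
  positive (`partitionFn_peierlsHubbard_eq_re`, `partitionFn_peierlsHubbard_re_pos`);
* **covariance under graph isomorphisms** (`relabel_peierlsHubbard`, cf. `relabel_hamiltonian`):
  relabelling the sites along `f : G ≅ G'` sends `H_G(T)` to `H_{G'}(T ∘ f⁻¹)`; in particular the
  partition function on the torus is invariant under translations of the phase configuration.

## References

* [Lieb1994] E. H. Lieb, Phys. Rev. Lett. 73 (1994) 2158, pp. 1–3.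
* E. H. Lieb, M. Loss, Duke Math. J. 71 (1993) 337, §2 (gauge invariance, fluxes).
-/

noncomputable section

namespace Literature.MathematicalPhysics.QuantumLattice

open Matrix Finset HubbardWave0
open scoped ComplexOrder

/-! ### Gauge (phase) transformations of the Fock space -/

section Gauge

variable {ι : Type*} [LinearOrder ι] [Fintype ι]

/-- The **gauge transformation** with phases `g : ι → ℂ` (`|g i| = 1`): the diagonal unitary
`|s⟩ ↦ (∏_{i ∈ s} g i) |s⟩`, i.e. `exp(i Σ_i α_i n_i)` for `g i = e^{iα_i}`.
[cite: Lieb1994, p. 3 ("gauge transformation `c_r → exp[-iΘ(l,r)] c_r`")] -/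
def orbitalPhase (g : ι → ℂ) : Matrix (Finset ι) (Finset ι) ℂ := diagonal fun s => ∏ i ∈ s, g i

variable {g : ι → ℂ}

omit [LinearOrder ι] [Fintype ι] in
/-- The gauge weights are phases: `w(s) w(s)^* = 1`. [folklore] -/
theorem orbitalPhaseWeight_mul_star (hg : ∀ i, ‖g i‖ = 1) (s : Finset ι) :
    (∏ i ∈ s, g i) * star (∏ i ∈ s, g i) = 1 := by
  rw [star_prod, ← Finset.prod_mul_distrib]
  refine Finset.prod_eq_one fun i _ => ?_
  rw [Complex.star_def, Complex.mul_conj, Complex.normSq_eq_norm_sq, hg i]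
  norm_num

/-- `D Dᴴ = 1`. [folklore] -/
theorem orbitalPhase_mul_conjTranspose (hg : ∀ i, ‖g i‖ = 1) :
    orbitalPhase g * (orbitalPhase g)ᴴ = 1 := by
  rw [orbitalPhase, diagonal_conjTranspose, diagonal_mul_diagonal, ← diagonal_one]
  congr 1
  funext s
  exact orbitalPhaseWeight_mul_star hg s

/-- `Dᴴ D = 1`. [folklore] -/
theorem conjTranspose_orbitalPhase_mul (hg : ∀ i, ‖g i‖ = 1) :
    (orbitalPhase g)ᴴ * orbitalPhase g = 1 := by
  rw [orbitalPhase, diagonal_conjTranspose, diagonal_mul_diagonal, ← diagonal_one]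
  congr 1
  funext s
  rw [Pi.star_apply, mul_comm]
  exact orbitalPhaseWeight_mul_star hg s

/-- The gauge transformation is unitary. [folklore] -/
theorem orbitalPhase_mem_unitary (hg : ∀ i, ‖g i‖ = 1) :
    orbitalPhase g ∈ unitary (Matrix (Finset ι) (Finset ι) ℂ) :=
  Unitary.mem_iff.2 ⟨conjTranspose_orbitalPhase_mul hg, orbitalPhase_mul_conjTranspose hg⟩

/-- **`D c†_i Dᴴ = g_i c†_i`.** [cite: Lieb1994, p. 3] -/
theorem orbitalPhase_conj_creation (hg : ∀ i, ‖g i‖ = 1) (i : ι) :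
    orbitalPhase g * creation i * (orbitalPhase g)ᴴ = g i • creation i := by
  ext s t
  simp only [orbitalPhase, diagonal_conjTranspose, mul_diagonal, diagonal_mul, creation_apply,
    Matrix.smul_apply, Pi.star_apply, smul_eq_mul]
  by_cases h : i ∉ t ∧ s = insert i t
  · obtain ⟨hi, rfl⟩ := h
    rw [if_pos ⟨hi, rfl⟩, Finset.prod_insert hi]
    linear_combination (g i * jwSign i t) * orbitalPhaseWeight_mul_star hg t
  · rw [if_neg h, mul_zero, zero_mul, mul_zero]

/-- **`D c_i Dᴴ = g_i^* c_i`.** [cite: Lieb1994, p. 3] -/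
theorem orbitalPhase_conj_annihilation (hg : ∀ i, ‖g i‖ = 1) (i : ι) :
    orbitalPhase g * annihilation i * (orbitalPhase g)ᴴ = star (g i) • annihilation i := by
  have h := congrArg conjTranspose (orbitalPhase_conj_creation hg i)
  rwa [conjTranspose_mul, conjTranspose_mul, conjTranspose_conjTranspose, ← Matrix.mul_assoc,
    conjTranspose_smul, creation, conjTranspose_conjTranspose] at h

/-- Conjugation by the gauge transformation as a `⋆`-algebra automorphism. [folklore] -/
def orbitalPhaseAut (hg : ∀ i, ‖g i‖ = 1) :
    Matrix (Finset ι) (Finset ι) ℂ ≃⋆ₐ[ℂ] Matrix (Finset ι) (Finset ι) ℂ :=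
  Unitary.conjStarAlgAut ℂ _ ⟨orbitalPhase g, orbitalPhase_mem_unitary hg⟩

/-- `orbitalPhaseAut` is `X ↦ D X Dᴴ`. [folklore] -/
theorem orbitalPhaseAut_apply (hg : ∀ i, ‖g i‖ = 1) (X : Matrix (Finset ι) (Finset ι) ℂ) :
    orbitalPhaseAut hg X = orbitalPhase g * X * (orbitalPhase g)ᴴ := by
  rw [orbitalPhaseAut, Unitary.conjStarAlgAut_apply]
  rfl

/-- `D (c†_i c_j) Dᴴ = g_i g_j^* c†_i c_j`. [cite: Lieb1994, p. 3] -/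
theorem orbitalPhaseAut_creation_mul_annihilation (hg : ∀ i, ‖g i‖ = 1) (i j : ι) :
    orbitalPhaseAut hg (creation i * annihilation j) = (g i * star (g j)) • (creation i * annihilation j) := by
  rw [map_mul, orbitalPhaseAut_apply, orbitalPhaseAut_apply, orbitalPhase_conj_creation hg,
    orbitalPhase_conj_annihilation hg, Matrix.smul_mul, Matrix.mul_smul, smul_smul]

/-- Number operators are gauge invariant: `D n_i Dᴴ = n_i`. [folklore] -/
theorem orbitalPhaseAut_numberAt (hg : ∀ i, ‖g i‖ = 1) (i : ι) :
    orbitalPhaseAut hg (numberAt i) = numberAt i := by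
  rw [numberAt, orbitalPhaseAut_creation_mul_annihilation hg, Complex.star_def, Complex.mul_conj,
    Complex.normSq_eq_norm_sq, hg i]
  simp

end Gauge

/-! ### Gauge covariance of the Peierls–Hubbard Hamiltonian -/

section Peierls

variable {Λ : Type*} [LinearOrder Λ] [Fintype Λ] (G : SimpleGraph Λ) [DecidableRel G.Adj]

/-- The orbital phases `(x, σ) ↦ g σ x` of a site- and spin-dependent gauge function. [folklore] -/
abbrev spinSitePhase (g : Fin 2 → Λ → ℂ) : Orb Λ → ℂ := fun i => g (ofLex i).2 (ofLex i).1

omit [LinearOrder Λ] [Fintype Λ] in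
/-- `spinSitePhase g (x, σ) = g σ x`. [folklore] -/
theorem spinSitePhase_orb (g : Fin 2 → Λ → ℂ) (x : Λ) (σ : Fin 2) : spinSitePhase g (orb x σ) = g σ x := rfl

/-- **Gauge covariance** [Lieb1994, p. 3]: with `T' σ x y = g σ x (g σ y)^* T σ x y`,
`D H(T) Dᴴ = H(T')`; the on-site interaction is gauge invariant. [cite: Lieb1994, p. 3] -/
theorem orbitalPhaseAut_peierlsHubbard (g : Fin 2 → Λ → ℂ) (hg : ∀ σ x, ‖g σ x‖ = 1)
    (T : Fin 2 → Λ → Λ → ℂ) (U : ℝ) :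
    orbitalPhaseAut (g := spinSitePhase g) (fun _ => hg _ _) (peierlsHubbard G T U) =
      peierlsHubbard G (fun σ x y => g σ x * star (g σ y) * T σ x y) U := by
  have hn : ∀ (x : Λ) (σ : Fin 2), orbitalPhaseAut (g := spinSitePhase g) (fun _ => hg _ _) (numberOp x σ) =
      numberOp x σ := fun x σ => orbitalPhaseAut_numberAt _ (orb x σ)
  rw [peierlsHubbard_def, peierlsHubbard_def, map_add, map_neg, map_smul, map_sum, map_sum]
  congr 2
  · simp only [map_sum]
    refine Finset.sum_congr rfl fun x _ => Finset.sum_congr rfl fun y _ =>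
      Finset.sum_congr rfl fun σ _ => ?_
    split_ifs
    · rw [map_smul, orbitalPhaseAut_creation_mul_annihilation, smul_smul, spinSitePhase_orb, spinSitePhase_orb,
        mul_comm (T σ x y)]
    · rw [map_zero]
  · refine Finset.sum_congr rfl fun x _ => ?_
    rw [map_mul, map_sub, map_sub, map_smul, map_one, hn, hn]

/-- **Gauge invariance of the partition function**: `Z_β(T') = Z_β(T)`.
[cite: Lieb1994, p. 1 ("depends on the `φ`'s only through the fluxes")] -/
theorem partitionFn_peierlsHubbard_gauge (g : Fin 2 → Λ → ℂ) (hg : ∀ σ x, ‖g σ x‖ = 1)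
    (T : Fin 2 → Λ → Λ → ℂ) (U β : ℝ) :
    (peierlsHubbard G (fun σ x y => g σ x * star (g σ y) * T σ x y) U).partitionFn β =
      (peierlsHubbard G T U).partitionFn β := by
  rw [← orbitalPhaseAut_peierlsHubbard G g hg T U, orbitalPhaseAut_apply, ← star_eq_conjTranspose]
  exact partitionFn_unitary_conj (orbitalPhase_mem_unitary fun _ => hg _ _) β _

/-! ### Hermiticity -/

/-- The on-site factor `n_{xσ} - ½` is Hermitian. [folklore] -/
theorem numberOp_sub_half_conjTranspose (x : Λ) (σ : Fin 2) :
    (numberOp x σ - (1 / 2 : ℂ) • (1 : Matrix (Finset (Orb Λ)) (Finset (Orb Λ)) ℂ))ᴴ =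
      numberOp x σ - (1 / 2 : ℂ) • 1 := by
  rw [conjTranspose_sub, conjTranspose_smul, conjTranspose_one, numberOp,
    show creation (orb x σ) * annihilation (orb x σ) = numberAt (orb x σ) from rfl,
    (numberAt_isHermitian _).eq]
  norm_num

/-- The two on-site factors commute (both are diagonal). [folklore] -/
theorem numberOp_sub_half_comm (x : Λ) :
    (numberOp x 0 - (1 / 2 : ℂ) • (1 : Matrix (Finset (Orb Λ)) (Finset (Orb Λ)) ℂ)) *
        (numberOp x 1 - (1 / 2 : ℂ) • 1) =
      (numberOp x 1 - (1 / 2 : ℂ) • 1) * (numberOp x 0 - (1 / 2 : ℂ) • 1) := by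
  have h : Commute (numberOp x 0) (numberOp x (1 : Fin 2)) := numberAt_commute (orb x 0) (orb x 1)
  have h1 : Commute (numberOp x 0)
      (numberOp x 1 - (1 / 2 : ℂ) • (1 : Matrix (Finset (Orb Λ)) (Finset (Orb Λ)) ℂ)) :=
    h.sub_right ((Commute.one_right _).smul_right _)
  exact (h1.sub_left ((Commute.one_left _).smul_left _)).eq

/-- **`H(T)` is Hermitian when `T σ y x = (T σ x y)^*`** (`φ(x,y) = -φ(y,x)` "for hermiticity",
[Lieb1994, p. 1]). [cite: Lieb1994, p. 1] -/
theorem peierlsHubbard_isHermitian (T : Fin 2 → Λ → Λ → ℂ) (hT : ∀ σ x y, T σ y x = star (T σ x y))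
    (U : ℝ) : (peierlsHubbard G T U).IsHermitian := by
  have hK : (∑ x : Λ, ∑ y : Λ, ∑ σ : Fin 2,
      if G.Adj x y then T σ x y • (creation (orb x σ) * annihilation (orb y σ)) else
        (0 : Matrix (Finset (Orb Λ)) (Finset (Orb Λ)) ℂ))ᴴ =
      ∑ x : Λ, ∑ y : Λ, ∑ σ : Fin 2,
        if G.Adj x y then T σ x y • (creation (orb x σ) * annihilation (orb y σ)) else 0 := by
    rw [conjTranspose_sum]
    simp only [conjTranspose_sum]
    rw [Finset.sum_comm]
    refine Finset.sum_congr rfl fun x _ => Finset.sum_congr rfl fun y _ =>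
      Finset.sum_congr rfl fun σ _ => ?_
    have hc : ∀ i : Orb Λ, (creation i)ᴴ = annihilation i := fun i => by
      rw [creation, conjTranspose_conjTranspose]
    by_cases h : G.Adj y x
    · rw [if_pos h, if_pos h.symm, conjTranspose_smul, conjTranspose_mul, annihilation_conjTranspose, hc,
        hT σ y x]
    · rw [if_neg h, if_neg (fun h' => h h'.symm), conjTranspose_zero]
  have hW : (∑ x : Λ, (numberOp x 0 - (1 / 2 : ℂ) • (1 : Matrix (Finset (Orb Λ)) (Finset (Orb Λ)) ℂ)) *
      (numberOp x 1 - (1 / 2 : ℂ) • 1))ᴴ =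
      ∑ x : Λ, (numberOp x 0 - (1 / 2 : ℂ) • 1) * (numberOp x 1 - (1 / 2 : ℂ) • 1) := by
    rw [conjTranspose_sum]
    refine Finset.sum_congr rfl fun x _ => ?_
    rw [conjTranspose_mul, numberOp_sub_half_conjTranspose, numberOp_sub_half_conjTranspose,
      numberOp_sub_half_comm]
  rw [IsHermitian, peierlsHubbard_def, conjTranspose_add, conjTranspose_neg, conjTranspose_smul, hK, hW,
    Complex.star_def, Complex.conj_ofReal]

/-- `Z_β(T)` is real for Hermitian hopping. [folklore] -/
theorem partitionFn_peierlsHubbard_eq_re (T : Fin 2 → Λ → Λ → ℂ) (hT : ∀ σ x y, T σ y x = star (T σ x y))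
    (U β : ℝ) :
    (peierlsHubbard G T U).partitionFn β = (((peierlsHubbard G T U).partitionFn β).re : ℂ) := by
  rw [(peierlsHubbard_isHermitian G T hT U).partitionFn_eq_ofReal, Complex.ofReal_re]

/-- `Z_β(T) > 0` for Hermitian hopping (the Fock space is never empty). [folklore] -/
theorem partitionFn_peierlsHubbard_re_pos (T : Fin 2 → Λ → Λ → ℂ)
    (hT : ∀ σ x y, T σ y x = star (T σ x y)) (U β : ℝ) :
    0 < ((peierlsHubbard G T U).partitionFn β).re := by
  rw [(peierlsHubbard_isHermitian G T hT U).partitionFn_eq_ofReal, Complex.ofReal_re]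
  exact (peierlsHubbard_isHermitian G T hT U).sum_exp_pos β

/-- `‖Z_β(T)‖ = Re Z_β(T)` for Hermitian hopping. [folklore] -/
theorem norm_partitionFn_peierlsHubbard (T : Fin 2 → Λ → Λ → ℂ)
    (hT : ∀ σ x y, T σ y x = star (T σ x y)) (U β : ℝ) :
    ‖(peierlsHubbard G T U).partitionFn β‖ = ((peierlsHubbard G T U).partitionFn β).re := by
  rw [partitionFn_peierlsHubbard_eq_re G T hT U β, Complex.norm_real, Complex.ofReal_re,
    Real.norm_of_nonneg (partitionFn_peierlsHubbard_re_pos G T hT U β).le]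

/-! ### Covariance under graph isomorphisms (relabelling of the sites) -/

variable {Λ' : Type*} [LinearOrder Λ'] [Fintype Λ'] (G' : SimpleGraph Λ') [DecidableRel G'.Adj]

/-- **Covariance of the Peierls–Hubbard Hamiltonian under graph isomorphisms** (cf.
`relabel_hamiltonian`): relabelling along `f : G ≅ G'` gives the Hamiltonian on `G'` with the
transported amplitudes `T' σ x' y' = T σ (f⁻¹ x') (f⁻¹ y')`. [folklore] -/
theorem relabel_peierlsHubbard (f : Λ ≃ Λ') (hG : ∀ x y, G'.Adj (f x) (f y) ↔ G.Adj x y)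
    (T : Fin 2 → Λ → Λ → ℂ) (U : ℝ) :
    relabel (Orb.mapEquiv f) (peierlsHubbard G T U) =
      peierlsHubbard G' (fun σ x' y' => T σ (f.symm x') (f.symm y')) U := by
  rw [peierlsHubbard_def, peierlsHubbard_def, map_add, map_neg, map_smul, map_sum, map_sum]
  congr 2
  · simp_rw [map_sum]
    rw [← f.sum_comp]
    refine Finset.sum_congr rfl fun x _ => ?_
    rw [← f.sum_comp]
    refine Finset.sum_congr rfl fun y _ => Finset.sum_congr rfl fun σ _ => ?_
    by_cases hadj : G.Adj x y
    · rw [if_pos hadj, if_pos ((hG x y).2 hadj), map_smul, map_mul, relabel_creation, relabel_annihilation,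
        Orb.mapEquiv_orb, Orb.mapEquiv_orb, Equiv.symm_apply_apply, Equiv.symm_apply_apply]
    · rw [if_neg hadj, if_neg (fun h => hadj ((hG x y).1 h)), map_zero]
  · rw [← f.sum_comp]
    refine Finset.sum_congr rfl fun x _ => ?_
    rw [map_mul, map_sub, map_sub, map_smul, map_one, relabel_mapEquiv_numberOp,
      relabel_mapEquiv_numberOp]

/-- **Invariance of the partition function under graph isomorphisms.** [folklore] -/
theorem partitionFn_peierlsHubbard_relabel (f : Λ ≃ Λ') (hG : ∀ x y, G'.Adj (f x) (f y) ↔ G.Adj x y)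
    (T : Fin 2 → Λ → Λ → ℂ) (U β : ℝ) :
    (peierlsHubbard G' (fun σ x' y' => T σ (f.symm x') (f.symm y')) U).partitionFn β =
      (peierlsHubbard G T U).partitionFn β := by
  rw [← relabel_peierlsHubbard G G' f hG T U, partitionFn_relabel]

end Peierls

end Literature.MathematicalPhysics.QuantumLattice

end
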